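import Summits.BirchSwinnertonDyer.BirchSwinnertonDyer.Theorems.PotentiallySupersingularLocalTowerTorsionFinite
import Literature.NumberTheory.EllipticCurves.Serre1967.PotentiallySupersingularNoStableLineProofs
import HarnessLib

/-!
# Fin_v at a potentially SUPERSINGULAR prime — UNCONDITIONAL: Serre 1967 §5 Prop. 8 is now a tree
# theorem; instance on the whole wild class O6 at `3`

Seat `bsd-wall-utd-p3`, gen 5 (cell `bsd-wall`, lane 3 UTD; service on route `UniversalToricDescent`,
crux #5 `WildSplitControlAtThree`, item stmt-BirchSwinnertonDyer-20386). ROUTE-FREE module (imports no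
`Theses.*`). Gen 17 of seat `bsd-potss-kmc` reduced Fin_v at an additive potentially supersingular prime
(`Theorems/PotentiallySupersingularLocalTowerTorsionFinite.lean`) to the cite-level named fact
`Serre1967.noStableDivisibleLine_of_potentiallySupersingular` (hypothesis `hS` of its three theorems).
That fact is now PROVED in the tree —
`Literature.NumberTheory.EllipticCurves.Serre1967.noStableDivisibleLine_of_potentiallySupersingular_holds`
(`Literature/NumberTheory/EllipticCurves/Serre1967/PotentiallySupersingularNoStableLineProofs.lean`,
this seat: divisible-line structure, `E[p^∞] ⊆ E₁` and the contraction `|x(pP)| ≥ min(|x(P)|^{p²},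
|x(P)|/μ)` from the division polynomials at a good supersingular place over ANY finite extension of
`ℚ_p` — no restriction on the ramification index —, the degree/valuation bound over `K_v`, potential
good reduction by adjoining `E[4]` / `E[3]`, decomposition-group transport) — so the three theorems hold
UNCONDITIONALLY:

* `noStableDivisibleLine_of_classO6_holds` — `hIrr` on the wild class O6 at `3` for every number field
  `K` and every `𝔭 ∋ 3`;
* `localTowerTorsionFiniteAt_of_potentiallySupersingular_holds` — Fin_v at every potentially
  supersingular ODD prime `p` (`ord_p j ≥ 0`, no unit root at any good place above `p`), every number
  field, every `ℤ_p`-extension, every degree-one `𝔭 ∣ p`;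
* `localTowerTorsionFiniteClaim_three_of_classO6_holds` — **`LocalTowerTorsionFiniteClaim W 3` on the
  whole wild class O6**, unconditionally: hypothesis `hFinV` of
  `UniversalToricDescentControl.wildSplitControlAtThree_of_facts` on ALL cell curves.

HONEST FRAMING: class-level statement (Fin_v for every globally minimal `E/ℚ` in `ClassO6 W 3`), now
free of named facts; crux #5 itself stays conditional on the two Poitou–Tate facts (items 20461/20462);
BSD is not proved by any of this.

References: [Serre1967GroupesPDivisibles] §5 Prop. 8, Lemme 3, Th. 4; [GreenbergLNM1716] §3 Lemma 3.3
(p. 87); [SilvermanAEC2009] VII.§§1–3, Cor. III.8.1.1; [Delbourgo1998] §1.5 (G).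
-/

noncomputable section

open scoped Classical

open WeierstrassCurve NumberField IsDedekindDomain Field Literature.NumberTheory.EllipticCurves
  Literature.NumberTheory.EllipticCurves.GreenbergSelmer
  Literature.NumberTheory.EllipticCurves.Rank1Residual
  Literature.NumberTheory.EllipticCurves.Rank1Residual.Typed
  Summit.BirchSwinnertonDyer.Rank1Residual
  Summit.BirchSwinnertonDyer.Rank1Residual.Additive
  Summit.BirchSwinnertonDyer.Rank1Residual.X11b
  Summit.BirchSwinnertonDyer.BirchSwinnertonDyer.Theorems.SchneiderFreeControlAtoms

set_option linter.dupNamespace false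

namespace Summit.BirchSwinnertonDyer.BirchSwinnertonDyer.Theorems.PotentiallySupersingularLocalTorsion

/-- **`hIrr` on the wild class O6 at `3` — unconditional.** For `E/ℚ` globally minimal in `ClassO6 W 3`,
every number field `K` and every `𝔭 ∋ 3`: no non-zero `D_𝔭`-stable `3`-divisible subgroup of
`E(K̄)[3^∞]` with `≤ 3` points of order `3` (`noStableDivisibleLine_of_classO6` with Serre's Prop. 8
supplied by the tree theorem `noStableDivisibleLine_of_potentiallySupersingular_holds`).
[cite: Serre1967GroupesPDivisibles, §5 Prop. 8] [cite: Delbourgo1998, §1.5 (G)] -/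
theorem noStableDivisibleLine_of_classO6_holds
    (W : WeierstrassCurve ℚ) [W.IsElliptic] [W.IsGloballyMinimal] (hO6 : ClassO6 W 3)
    (K : Type) [Field K] [NumberField K] (𝔭 : HeightOneSpectrum (𝓞 K))
    (h𝔭 : ((3 : ℕ) : 𝓞 K) ∈ 𝔭.asIdeal) :
    ∀ N : AddSubgroup ((W.baseChange K).geomPrimaryTorsion 3),
      (∀ d ∈ decomp 𝔭, ∀ c ∈ N, d • c ∈ N) → (∀ c ∈ N, ∃ c' ∈ N, 3 • c' = c) →
      Set.ncard {c : (W.baseChange K).geomPrimaryTorsion 3 | c ∈ N ∧ 3 • c = 0} ≤ 3 → N = ⊥ :=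
  noStableDivisibleLine_of_classO6 Serre1967.noStableDivisibleLine_of_potentiallySupersingular_holds
    W hO6 K 𝔭 h𝔭

/-- **Fin_v at a potentially SUPERSINGULAR odd prime — generic, unconditional.** For `E/ℚ` with
`ord_p j ≥ 0` and no unit root at any good place above the odd prime `p` of any number field, every
number field `K`, every `ℤ_p`-extension `κ` of `K` and every degree-one prime `𝔭 ∣ p`:
`LocalTowerTorsionFiniteAt (W.baseChange K) p κ 𝔭` (`localTowerTorsionFiniteAt_of_potentiallySupersingular`
with Serre's Prop. 8 supplied by the tree theorem). [cite: Serre1967GroupesPDivisibles, §5 Prop. 8]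
[cite: GreenbergLNM1716, §3 Lemma 3.3 (p. 87)] [cite: SilvermanAEC2009, Cor. III.8.1.1] -/
theorem localTowerTorsionFiniteAt_of_potentiallySupersingular_holds
    (W : WeierstrassCurve ℚ) [W.IsElliptic] (p : ℕ) [Fact p.Prime] (hp2 : p ≠ 2)
    (hj : 0 ≤ padicValRat p W.j)
    (hss : ∀ (F : Type) [Field F] [NumberField F] (w : HeightOneSpectrum (𝓞 F)),
      ((p : ℕ) : 𝓞 F) ∈ w.asIdeal → (W.baseChange F).HasGoodReductionAt w →
        ¬ (W.baseChange F).HasUnitRootAt w)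
    (K : Type) [Field K] [NumberField K] (κ : ZpExtension K p) (𝔭 : HeightOneSpectrum (𝓞 K))
    (h𝔭 : ((p : ℕ) : 𝓞 K) ∈ 𝔭.asIdeal) (he : 𝔭.asIdeal.ramificationIdx (𝓞 ℚ) = 1)
    (hf : 𝔭.asIdeal.inertiaDeg (𝓞 ℚ) = 1) :
    LocalTowerTorsionFiniteAt (W.baseChange K) p κ 𝔭 :=
  localTowerTorsionFiniteAt_of_potentiallySupersingular
    Serre1967.noStableDivisibleLine_of_potentiallySupersingular_holds W p hp2 hj hss K κ 𝔭 h𝔭 he hf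

/-- **`LocalTowerTorsionFiniteClaim W 3` on the whole WILD class O6 — unconditional** (every imaginary
quadratic `K` with `3` split, every `ℤ₃`-extension): hypothesis `hFinV` of
`UniversalToricDescentControl.wildSplitControlAtThree_of_facts` on ALL cell curves, with Serre 1967
§5 Prop. 8 supplied by the tree theorem `noStableDivisibleLine_of_potentiallySupersingular_holds`.
[cite: Serre1967GroupesPDivisibles, §5 Prop. 8] [cite: GreenbergLNM1716, §3 Lemma 3.3 (p. 87)] -/
theorem localTowerTorsionFiniteClaim_three_of_classO6_holds
    (W : WeierstrassCurve ℚ) [W.IsElliptic] [W.IsGloballyMinimal] (hO6 : ClassO6 W 3) :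
    LocalTowerTorsionFiniteClaim W 3 :=
  localTowerTorsionFiniteClaim_three_of_classO6
    Serre1967.noStableDivisibleLine_of_potentiallySupersingular_holds W hO6

end Summit.BirchSwinnertonDyer.BirchSwinnertonDyer.Theorems.PotentiallySupersingularLocalTorsion

end
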